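import Literature.Barriers.CriticalPhenomena.PlaquetteWalkHoleRootWoundCost
import Literature.Barriers.CriticalPhenomena.PlaquetteWalkAngleLimitCoefficientWound
import HarnessLib

/-!
# Barrier catalogue (SAWScalingLimit): runs keep their direction, three isolated turns in the row of the rooted rhombus, wound `NS`
walks with a vertical end cost at least `7`, and `WoundCostGE 5` at every hole root («WOUND COST ≥ 5 FOR EVERY GROUP MEMBER»)

Fourth and closing brick of the «WOUND COST ≥ 5» programme (DESIGN-next b-engine-1 g23 §2.1), after `PlaquetteWalkHoleRootWoundCost` (every
wound class-`B2a` walk from a hole root costs `≥ 5`). In Glazman–Manolescu's grouping a class-`B2a` walk `ω` at `r` whose first arc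
in `r` is a TURN (`NS` group) carries a class-`B2b` EXTENSION (one more arc inside `r`, ending on the fourth side); the extension
turns the isolated turn at `r` into a two-arc plaquette and moves the end from `ω.1` to the fourth side, so its cost is `cost ω − 2`
when `ω.1` is vertical. The hypothesis `WoundCostGE 5` of `PlaquetteWalkAngleLimitCoefficientWound` therefore needs `cost ω ≥ 7` for
wound `NS` walks with a vertical end — proved here:

* RUNS (`YBWalk.fc_succ_eq_of_sOut_W/E`, `YBWalk.sOut_WE_of_row_eq`, ★ `YBWalk.run_W` / `YBWalk.run_E`: a maximal run of same-row
  arcs keeps its direction, and its plaquettes march one column per arc; ★ `YBWalk.exists_run_start` / `YBWalk.exists_run_end`: the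
  run through a given arc starts with a VERTICAL entry at an index `≥ 1` and ends with a vertical exit or at the walk's last arc,
  with the column bookkeeping in either direction);
* ★★ `ΩG.three_turns_in_row_E` / `ΩG.three_turns_in_row_W`: if the rooted rhombus `r` lies in a singly visited row `Y ≠ w.2`, the
  first arc in `r` turns and the walk ends on the `E` (resp. `W`) side of `r`, then row `Y` holds THREE different `[corner]`/`[coCorner]`
  plaquettes — `r`, the far end of the run through `r` (on the side away from the end), and the first plaquette of the final run
  (on the side of the end) —, separated by their columns;
* `ΩG.eq_firstHitG_of_fc_eq` (class `B2a`: `r` carries only the first-crossing arc);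
* ★★★ `ΩG.seven_le_cost_of_wound_NS`: a wound class-`B2a` walk from a hole root whose first arc in `r` turns and whose end is a
  vertical side of `r` has `cost ≥ 7` (`2 + 2 + 1` isolated turns when `r` is off the extreme rows, `3 + 2` when it is in one; COST
  PARITY lifts `5` to `6`; the vertical end adds `1`).

SECOND HALF (the group assembly, «EXTENSION COST / WOUND COST ≥ 5 FOR EVERY GROUP MEMBER»):
* `ΩG.isolated_turn_ext₃` — an isolated turn of `ω` in a plaquette `≠ r` is an isolated turn of the extension `ext₃ ω`;
  `ΩG.end_vertical_of_rooted_top/bottom` — `r` in an extreme row and a turning first arc force a VERTICAL end;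
* ★★ `ΩG.four_turns_off_r` — a wound `NS` walk has four `[corner]`/`[coCorner]` plaquettes other than `r`;
* ★★★ `ΩG.five_le_cost_ext₃` — `5 ≤ cost (slotOfSide (ext₃ ω).1) (ext₃ ω).2.mids`: the four turns survive the extension, and the
  fourth side `z₃` is slanted exactly when the end `ω.1` is vertical, so COST PARITY for the extension lifts `4` to `5` in that case
  while a vertical `z₃` contributes the `1` itself;
* ★★★ `woundCostGE_five` — `WoundCostGE Dl (w.side W) f₀ hr 5` (the hypothesis of `PlaquetteWalkAngleLimitCoefficientWound`) for every
  finite domain `dom Dl`, every `W`-normalised hole root (`holeFaceW w ∉ dom Dl`) and every rooted rhombus `f₀` — the class-`B2a` members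
  by `ΩG.five_le_cost_of_wound` (their own excursion winds: `ΩG.unwound_iff_AJ_root_eq_zero`), the extensions by `five_le_cost_ext₃`;
  ★★★ `ybVFPoly_coeff_eq_woundLimitCoeff_five` — hence, with NO hypothesis, the coefficient of `Z^{4K−4}` of the cleared vertex
  functional `P = (Z²·Den)^K·VF_D(a, f₀; ·)` is the level-`5` wound limit sum `Λ₅ = woundLimitCoeff 5` and `deg P ≤ 4K − 4`.

[GlazmanManolescu2019 §1 Fig. 1, Lemma 2.1 (proof: the groups), Remark 2.2; Glazman 2015 Lemma 3.1 (proof, pp. 6–7)]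
-/

noncomputable section

namespace Literature.Probability.RandomPlanarGeometry.SAW.YangBaxter

open Real
open Literature.Barriers.CriticalPhenomena.PlaquetteWalk

open private fc_fh fc_ne fh_add_Mv three_le_Mv arcFace_ne_of_isB2a sides_distinctG returnSide_of_isB2a from
  Literature.Probability.RandomPlanarGeometry.YangBaxterSAWGeneralDomain

namespace YBWalk

variable {D : Set Face} {a z : MidEdge} (γ : YBWalk D a z)

/-! ## Horizontal steps: through `W` to the west neighbour, through `E` to the east neighbour -/

/-- An arc leaving through `W` is followed by an arc in the WEST neighbour, entered through its `E` side.
[cite: GlazmanManolescu2019, §1, Fig. 1 (consecutive arcs lie in adjacent rhombi)] -/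
theorem fc_succ_eq_of_sOut_W {i : ℕ} (hi : i + 1 < γ.arcs.length) (hW : γ.sOut i = .W) :
    γ.fc (i + 1) = ((γ.fc i).1 - 1, (γ.fc i).2) ∧ γ.sIn (i + 1) = .E := by
  obtain ⟨-, hout⟩ := γ.side_sIn_eq_nth (show i < γ.arcs.length by omega)
  obtain ⟨hin, -⟩ := γ.side_sIn_eq_nth hi
  rcases hfc : γ.fc i with ⟨k, j⟩
  rw [hW, hfc] at hout
  have e : (γ.fc (i + 1)).side (γ.sIn (i + 1)) = .vert k j := by rw [hin, ← hout]; rfl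
  rcases eq_of_side_eq_vert e with ⟨h2, hs⟩ | ⟨h2, hs⟩
  · exact absurd (hfc.trans h2.symm) (γ.fc_succ_ne hi)
  · exact ⟨h2, hs⟩

/-- An arc leaving through `E` is followed by an arc in the EAST neighbour, entered through its `W` side.
[cite: GlazmanManolescu2019, §1, Fig. 1 (consecutive arcs lie in adjacent rhombi)] -/
theorem fc_succ_eq_of_sOut_E {i : ℕ} (hi : i + 1 < γ.arcs.length) (hE : γ.sOut i = .E) :
    γ.fc (i + 1) = ((γ.fc i).1 + 1, (γ.fc i).2) ∧ γ.sIn (i + 1) = .W := by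
  obtain ⟨-, hout⟩ := γ.side_sIn_eq_nth (show i < γ.arcs.length by omega)
  obtain ⟨hin, -⟩ := γ.side_sIn_eq_nth hi
  rcases hfc : γ.fc i with ⟨k, j⟩
  rw [hE, hfc] at hout
  have e : (γ.fc (i + 1)).side (γ.sIn (i + 1)) = .vert (k + 1) j := by rw [hin, ← hout]; rfl
  rcases eq_of_side_eq_vert e with ⟨h2, hs⟩ | ⟨h2, hs⟩
  · exact ⟨h2, hs⟩
  · exact absurd (hfc.trans (by rw [h2]; simp)) (γ.fc_succ_ne hi)

/-- Two consecutive arcs in the same row are joined through a vertical side: the first leaves through `W` or `E`.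
[cite: GlazmanManolescu2019, §1, Fig. 1] -/
theorem sOut_WE_of_row_eq {i : ℕ} (hi : i + 1 < γ.arcs.length) (h : (γ.fc (i + 1)).2 = (γ.fc i).2) :
    γ.sOut i = .W ∨ γ.sOut i = .E := by
  cases hs : γ.sOut i
  · exact Or.inl rfl
  · exact Or.inr rfl
  · have e := γ.fc_succ_eq_of_sOut_S hi hs; rw [e] at h; simp only at h; omega
  · have e := γ.fc_succ_eq_of_sOut_N hi hs; rw [e] at h; simp only at h; omega

/-! ## Runs keep their direction -/

/-- ★ **A RUN HEADING WEST KEEPS HEADING WEST**: if the arcs `i, i+1, …, i+n` lie in one row and the arc `i` leaves through `W`,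
then every arc `i ≤ k < i + n` leaves through `W` and the plaquette of the arc `i + n` lies `n` columns to the west.
[cite: GlazmanManolescu2019, §1, Fig. 1 (an arc joins two different sides of its rhombus)] -/
theorem run_W {i : ℕ} (hW : γ.sOut i = .W) : ∀ n : ℕ, i + n < γ.arcs.length →
    (∀ k, i ≤ k → k ≤ i + n → (γ.fc k).2 = (γ.fc i).2) →
    (∀ k, i ≤ k → k < i + n → γ.sOut k = .W) ∧ (γ.fc (i + n)).1 + n = (γ.fc i).1
  | 0, _, _ => ⟨fun k h1 h2 => by omega, by simp⟩
  | n + 1, hlen, hrow => by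
      obtain ⟨hall, hx⟩ := run_W hW n (by omega) (fun k h1 h2 => hrow k h1 (by omega))
      have hWn : γ.sOut (i + n) = .W := by
        rcases Nat.eq_zero_or_pos n with rfl | hn
        · simpa using hW
        · have hprev := hall (i + n - 1) (by omega) (by omega)
          obtain ⟨-, hin⟩ := γ.fc_succ_eq_of_sOut_W (i := i + n - 1) (by omega) hprev
          rw [show i + n - 1 + 1 = i + n by omega] at hin
          have hne := γ.sIn_ne_sOut (show i + n < γ.arcs.length by omega)
          rw [hin] at hne
          have hr := (hrow (i + n + 1) (by omega) (by omega)).trans (hrow (i + n) (by omega) (by omega)).symm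
          rcases γ.sOut_WE_of_row_eq (by omega) hr with e | e
          · exact e
          · exact absurd e.symm hne
      refine ⟨fun k h1 h2 => ?_, ?_⟩
      · rcases Nat.lt_or_ge k (i + n) with hk | hk
        · exact hall k h1 hk
        · rw [show k = i + n by omega]; exact hWn
      · obtain ⟨hfc, -⟩ := γ.fc_succ_eq_of_sOut_W (by omega) hWn
        rw [show i + (n + 1) = i + n + 1 by omega, hfc]
        push_cast
        omega

/-- ★ **A RUN HEADING EAST KEEPS HEADING EAST** (the mirror statement). [cite: GlazmanManolescu2019, §1, Fig. 1] -/
theorem run_E {i : ℕ} (hE : γ.sOut i = .E) : ∀ n : ℕ, i + n < γ.arcs.length →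
    (∀ k, i ≤ k → k ≤ i + n → (γ.fc k).2 = (γ.fc i).2) →
    (∀ k, i ≤ k → k < i + n → γ.sOut k = .E) ∧ (γ.fc (i + n)).1 = (γ.fc i).1 + n
  | 0, _, _ => ⟨fun k h1 h2 => by omega, by simp⟩
  | n + 1, hlen, hrow => by
      obtain ⟨hall, hx⟩ := run_E hE n (by omega) (fun k h1 h2 => hrow k h1 (by omega))
      have hEn : γ.sOut (i + n) = .E := by
        rcases Nat.eq_zero_or_pos n with rfl | hn
        · simpa using hE
        · have hprev := hall (i + n - 1) (by omega) (by omega)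
          obtain ⟨-, hin⟩ := γ.fc_succ_eq_of_sOut_E (i := i + n - 1) (by omega) hprev
          rw [show i + n - 1 + 1 = i + n by omega] at hin
          have hne := γ.sIn_ne_sOut (show i + n < γ.arcs.length by omega)
          rw [hin] at hne
          have hr := (hrow (i + n + 1) (by omega) (by omega)).trans (hrow (i + n) (by omega) (by omega)).symm
          rcases γ.sOut_WE_of_row_eq (by omega) hr with e | e
          · exact absurd e.symm hne
          · exact e
      refine ⟨fun k h1 h2 => ?_, ?_⟩
      · rcases Nat.lt_or_ge k (i + n) with hk | hk
        · exact hall k h1 hk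
        · rw [show k = i + n by omega]; exact hEn
      · obtain ⟨hfc, -⟩ := γ.fc_succ_eq_of_sOut_E (by omega) hEn
        rw [show i + (n + 1) = i + n + 1 by omega, hfc]
        push_cast
        omega

/-! ## The run through a given arc: its first arc (an entry turn) and its last arc (an exit turn or the walk's end) -/

/-- ★ **THE START OF A RUN**: the maximal run of same-row arcs ending at the arc `m` starts at an index `1 ≤ j₀ ≤ m` (when the first
arc of the walk lies in another row) with an arc entering VERTICALLY (`S`/`N`), and the run heads west — every arc before `m` leaves
through `W`, the plaquette of `m` lies `m − j₀` columns west of that of `j₀` — or east. [cite: GlazmanManolescu2019, §1, Fig. 1] -/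
theorem exists_run_start {m : ℕ} (hm : m < γ.arcs.length) (h0 : (γ.fc 0).2 ≠ (γ.fc m).2) :
    ∃ j₀, 1 ≤ j₀ ∧ j₀ ≤ m ∧ (∀ k, j₀ ≤ k → k ≤ m → (γ.fc k).2 = (γ.fc m).2) ∧ (γ.fc (j₀ - 1)).2 ≠ (γ.fc m).2 ∧
      (γ.sIn j₀ = .S ∨ γ.sIn j₀ = .N) ∧
      (((∀ k, j₀ ≤ k → k < m → γ.sOut k = .W) ∧ (γ.fc m).1 + (m - j₀ : ℕ) = (γ.fc j₀).1) ∨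
        ((∀ k, j₀ ≤ k → k < m → γ.sOut k = .E) ∧ (γ.fc m).1 = (γ.fc j₀).1 + (m - j₀ : ℕ))) := by
  classical
  have hex : ∃ j, ∀ k, j ≤ k → k ≤ m → (γ.fc k).2 = (γ.fc m).2 := ⟨m, fun k h1 h2 => by rw [show k = m by omega]⟩
  obtain hspec := Nat.find_spec hex
  set j₀ := Nat.find hex with hj₀
  have hj₀m : j₀ ≤ m := Nat.find_min' hex (fun k h1 h2 => by rw [show k = m by omega])
  have hj₀1 : 1 ≤ j₀ := by
    by_contra hlt
    have e0 : j₀ = 0 := by omega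
    exact h0 (hspec 0 (by omega) (by omega))
  have hprev : (γ.fc (j₀ - 1)).2 ≠ (γ.fc m).2 := by
    intro e
    have := Nat.find_min hex (m := j₀ - 1) (by omega)
    exact this fun k h1 h2 => by
      rcases Nat.lt_or_ge k j₀ with hk | hk
      · rw [show k = j₀ - 1 by omega]; exact e
      · exact hspec k hk h2
  have hj₀lt : j₀ < γ.arcs.length := by omega
  -- the entry is vertical: a horizontal entry would put the predecessor in the same row
  have hSN : γ.sIn j₀ = .S ∨ γ.sIn j₀ = .N := by
    have hrow := hspec j₀ le_rfl hj₀m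
    cases hs : γ.sIn j₀
    · exact absurd ((γ.fc_pred_row_of_sIn_WE hj₀lt hj₀1 (Or.inl hs)).trans hrow) hprev
    · exact absurd ((γ.fc_pred_row_of_sIn_WE hj₀lt hj₀1 (Or.inr hs)).trans hrow) hprev
    · exact Or.inl rfl
    · exact Or.inr rfl
  refine ⟨j₀, hj₀1, hj₀m, hspec, hprev, hSN, ?_⟩
  -- direction
  rcases Nat.lt_or_ge j₀ m with hlt | hge
  · have hrowrun : ∀ k, j₀ ≤ k → k ≤ j₀ + (m - j₀) → (γ.fc k).2 = (γ.fc j₀).2 := fun k h1 h2 =>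
      (hspec k h1 (by omega)).trans (hspec j₀ le_rfl hj₀m).symm
    have hr : (γ.fc (j₀ + 1)).2 = (γ.fc j₀).2 := (hspec (j₀ + 1) (by omega) (by omega)).trans (hspec j₀ le_rfl hj₀m).symm
    rcases γ.sOut_WE_of_row_eq (by omega) hr with hW | hE
    · left
      obtain ⟨hall, hx⟩ := γ.run_W hW (m - j₀) (by rw [show j₀ + (m - j₀) = m by omega]; exact hm) hrowrun
      rw [show j₀ + (m - j₀) = m by omega] at hall hx
      exact ⟨hall, hx⟩
    · right
      obtain ⟨hall, hx⟩ := γ.run_E hE (m - j₀) (by rw [show j₀ + (m - j₀) = m by omega]; exact hm) hrowrun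
      rw [show j₀ + (m - j₀) = m by omega] at hall hx
      exact ⟨hall, hx⟩
  · have e : j₀ = m := le_antisymm hj₀m hge
    left
    refine ⟨fun k h1 h2 => by omega, ?_⟩
    rw [e]; simp

/-- ★ **THE END OF A RUN**: the maximal run of same-row arcs starting at the arc `m` ends at an index `j₁ ≥ m` which is either the
walk's LAST arc or an arc leaving VERTICALLY (`S`/`N`) into another row; the run heads west (every arc from `m` to before `j₁` leaves
through `W`, the plaquette of `j₁` lies `j₁ − m` columns west) or east. [cite: GlazmanManolescu2019, §1, Fig. 1] -/
theorem exists_run_end {m : ℕ} (hm : m < γ.arcs.length) :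
    ∃ j₁, m ≤ j₁ ∧ j₁ < γ.arcs.length ∧ (∀ k, m ≤ k → k ≤ j₁ → (γ.fc k).2 = (γ.fc m).2) ∧
      (j₁ + 1 = γ.arcs.length ∨ (j₁ + 1 < γ.arcs.length ∧ (γ.fc (j₁ + 1)).2 ≠ (γ.fc m).2 ∧ (γ.sOut j₁ = .S ∨ γ.sOut j₁ = .N))) ∧
      (((∀ k, m ≤ k → k < j₁ → γ.sOut k = .W) ∧ (γ.fc j₁).1 + (j₁ - m : ℕ) = (γ.fc m).1) ∨
        ((∀ k, m ≤ k → k < j₁ → γ.sOut k = .E) ∧ (γ.fc j₁).1 = (γ.fc m).1 + (j₁ - m : ℕ))) := by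
  classical
  -- the first index `j ≥ m` at which the run stops
  have hex : ∃ n, m + n < γ.arcs.length ∧ (m + n + 1 = γ.arcs.length ∨ (m + n + 1 < γ.arcs.length ∧ (γ.fc (m + n + 1)).2 ≠ (γ.fc m).2)) :=
    by
    by_contra hne
    push Not at hne
    -- then every arc after `m` lies in the row of `m` and the walk never ends: induction reaches the last arc
    have key : ∀ n, m + n < γ.arcs.length ∧ (γ.fc (m + n)).2 = (γ.fc m).2 := by
      intro n
      induction n with
      | zero => exact ⟨by simpa using hm, by simp⟩
      | succ n ih =>
        obtain ⟨h1, -⟩ := ih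
        have h3 := hne n h1
        refine ⟨by omega, ?_⟩
        rw [show m + (n + 1) = m + n + 1 by omega]
        exact h3.2 (by omega)
    have := (key γ.arcs.length).1; omega
  obtain ⟨hlen, hstop⟩ := Nat.find_spec hex
  set n₁ := Nat.find hex with hn₁
  have hmin : ∀ n < n₁, ¬(m + n < γ.arcs.length ∧ (m + n + 1 = γ.arcs.length ∨
      (m + n + 1 < γ.arcs.length ∧ (γ.fc (m + n + 1)).2 ≠ (γ.fc m).2))) := fun n hn => Nat.find_min hex hn
  -- all arcs `m … m + n₁` lie in the row of `m`
  have hrowrun : ∀ k, m ≤ k → k ≤ m + n₁ → (γ.fc k).2 = (γ.fc m).2 := by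
    intro k h1 h2
    induction k, h1 using Nat.le_induction with
    | base => rfl
    | succ k hk ih =>
      have ih' := ih (by omega)
      have hk' := hmin (k - m) (by omega)
      rw [show m + (k - m) = k by omega] at hk'
      push Not at hk'
      exact (hk' (by omega)).2 (by omega)
  refine ⟨m + n₁, by omega, hlen, hrowrun, ?_, ?_⟩
  · rcases hstop with h | ⟨h1, h2⟩
    · exact Or.inl h
    · refine Or.inr ⟨h1, h2, ?_⟩
      have hrow := hrowrun (m + n₁) (by omega) le_rfl
      cases hs : γ.sOut (m + n₁)
      · exact absurd ((γ.fc_succ_row_of_sOut_WE h1 (Or.inl hs)).trans hrow) h2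
      · exact absurd ((γ.fc_succ_row_of_sOut_WE h1 (Or.inr hs)).trans hrow) h2
      · exact Or.inl rfl
      · exact Or.inr rfl
  · rcases Nat.eq_zero_or_pos n₁ with hz | hpos
    · left
      refine ⟨fun k h1 h2 => by omega, ?_⟩
      rw [hz]; simp
    · have hr : (γ.fc (m + 1)).2 = (γ.fc m).2 := hrowrun (m + 1) (by omega) (by omega)
      rcases γ.sOut_WE_of_row_eq (by omega) hr with hW | hE
      · left
        obtain ⟨hall, hx⟩ := γ.run_W hW n₁ hlen hrowrun
        rw [show m + n₁ - m = n₁ by omega]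
        exact ⟨hall, hx⟩
      · right
        obtain ⟨hall, hx⟩ := γ.run_E hE n₁ hlen hrowrun
        rw [show m + n₁ - m = n₁ by omega]
        exact ⟨hall, hx⟩

end YBWalk

/-! ## Three isolated turns in the row of `r` when the walk ends on a vertical side of `r` -/

namespace ΩG

variable {D : Set Face} {w r : Face} {ω : ΩG D (w.side .W) r}

/-- ★★ **THREE ISOLATED TURNS IN THE ROW OF `r`, END SIDE `E`.** Let `ω` be a class-`B2a` walk from a hole root whose row-`Y`
plaquettes are singly visited, with `r` in row `Y ≠ w.2`, whose first arc in `r` is a TURN and whose end is the `E` side of `r`. Then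
row `Y` contains three different `[corner]`/`[coCorner]` plaquettes: `r` itself; the far end of the run through `r` (west of `r`: the
run leaves `r` westward, or reaches `r` from the west, since `E` is reserved for the end); and the first plaquette of the final run,
which reaches the `E` side of `r` from the east. [cite: GlazmanManolescu2019, §1, Fig. 1; Lemma 2.1 (the classes of walks at a rhombus)]
[cite: Glazman2015WeightedSAW, Lemma 3.1 (proof, pp. 6–7)] -/
theorem three_turns_in_row_E (hh : holeFaceW w ∉ D) (hr : RootedFace D (w.side .W) r) (h : ω.IsB2a) {Y : ℤ}
    (hsv : ∀ i j, i < ω.2.arcs.length → j < ω.2.arcs.length → (ω.2.fc i).2 = Y → ω.2.fc i = ω.2.fc j → i = j)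
    (hrY : r.2 = Y) (hwY : w.2 ≠ Y) (hNS : arcKind (ω.2.sIn ω.2.firstHitG) (ω.2.sOut ω.2.firstHitG) ≠ .straight)
    (hzE : ω.1 = .E) :
    ∃ T : Finset Face,
      (∀ f ∈ T, (f ∈ facesL ω.2.mids ∧ (kindsL ω.2.mids f = [.corner] ∨ kindsL ω.2.mids f = [.coCorner])) ∧ f.2 = Y) ∧
        3 ≤ T.card := by
  classical
  have hF := ω.fh_lt h
  obtain ⟨hfcF, hsInF, hsOutF⟩ := fc_fh ω hr h
  have hlen3 : ω.2.firstHitG + 3 ≤ ω.2.arcs.length := by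
    have := three_le_Mv hr h; have := fh_add_Mv h; unfold ΩG.Mv at *; omega
  have hlen : 0 < ω.2.arcs.length := by omega
  have hL : ω.2.arcs.length - 1 < ω.2.arcs.length := by omega
  have hFL : ω.2.firstHitG < ω.2.arcs.length - 1 := by omega
  have h0 : ω.2.fc 0 = w := fc_zero_eq_root w hh ω.2 hlen
  have h0Y : (ω.2.fc 0).2 ≠ Y := by rw [h0]; exact hwY
  have hrFY : (ω.2.fc ω.2.firstHitG).2 = Y := by rw [hfcF]; exact hrY
  -- the last arc ends on `r.side E` and does not lie in `r`: it lies in the east neighbour and leaves through `W`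
  obtain ⟨-, hout⟩ := ω.2.side_sIn_eq_nth hL
  rw [show ω.2.arcs.length - 1 + 1 = ω.2.arcs.length by omega, ω.2.nth_length] at hout
  have hlastne : ω.2.fc (ω.2.arcs.length - 1) ≠ r := fc_ne ω hr h hFL hL
  have e := hout.trans (show r.side ω.1 = .vert (r.1 + 1) r.2 by rw [hzE]; rfl)
  obtain ⟨hfcL, hsOutL⟩ : ω.2.fc (ω.2.arcs.length - 1) = (r.1 + 1, r.2) ∧ ω.2.sOut (ω.2.arcs.length - 1) = .W := by
    rcases eq_of_side_eq_vert e with ⟨h2, hs⟩ | ⟨h2, -⟩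
    · exact ⟨h2, hs⟩
    · have e2 : ω.2.fc (ω.2.arcs.length - 1) = r := h2.trans (Prod.ext (by simp) rfl)
      exact absurd e2 hlastne
  have hLY : (ω.2.fc (ω.2.arcs.length - 1)).2 = Y := by rw [hfcL]; exact hrY
  -- the three sides at `r` are pairwise distinct
  have hd := ω.2.sides_distinctG hr h.1
  rw [ω.returnSide_of_isB2a h] at hd
  have hs0 : ω.2.sIn ω.2.firstHitG ≠ ω.1 := by rw [hsInF]; exact fun e => hd.2.1 e.symm
  have hs1 : ω.2.sOut ω.2.firstHitG ≠ ω.1 := by rw [hsOutF]; exact fun e => hd.2.2 e.symm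
  have h10 : ω.2.sIn ω.2.firstHitG ≠ ω.2.sOut ω.2.firstHitG := ω.2.sIn_ne_sOut hF
  -- isolated turns in row `Y`
  have hiso : ∀ i, i < ω.2.arcs.length → (ω.2.fc i).2 = Y → arcKind (ω.2.sIn i) (ω.2.sOut i) ≠ .straight →
      ω.2.fc i ∈ facesL ω.2.mids ∧ (kindsL ω.2.mids (ω.2.fc i) = [.corner] ∨ kindsL ω.2.mids (ω.2.fc i) = [.coCorner]) :=
    fun i hi hrow hk => isolated_turn hi (fun j hj he => (hsv i j hi hj hrow he.symm).symm) hk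
  have hPr := hiso _ hF hrFY hNS
  rw [hfcF] at hPr
  -- ★ q: the final run starts with an entry turn, east of `r`
  obtain ⟨j₂, hj₂1, hj₂L, hrun₂, -, hSN₂, hdir₂⟩ := ω.2.exists_run_start hL (by rw [hLY]; exact h0Y)
  have hqx : r.1 + 1 ≤ (ω.2.fc j₂).1 := by
    rcases hdir₂ with ⟨-, hx⟩ | ⟨hall, hx⟩
    · rw [hfcL] at hx; simp only at hx; omega
    · rcases Nat.lt_or_ge j₂ (ω.2.arcs.length - 1) with hlt | hge
      · -- heading east, the last arc would enter AND leave through `W`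
        have hE' := hall (ω.2.arcs.length - 1 - 1) (by omega) (by omega)
        obtain ⟨-, hin⟩ := ω.2.fc_succ_eq_of_sOut_E (i := ω.2.arcs.length - 1 - 1) (by omega) hE'
        rw [show ω.2.arcs.length - 1 - 1 + 1 = ω.2.arcs.length - 1 by omega] at hin
        exact absurd (hin.trans hsOutL.symm) (ω.2.sIn_ne_sOut hL)
      · rw [show j₂ = ω.2.arcs.length - 1 by omega, hfcL]
  have hq_out : ω.2.sOut j₂ = .W ∨ ω.2.sOut j₂ = .E := by
    rcases Nat.lt_or_ge j₂ (ω.2.arcs.length - 1) with hlt | hge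
    · exact ω.2.sOut_WE_of_row_eq (by omega)
        ((hrun₂ (j₂ + 1) (by omega) (by omega)).trans (hrun₂ j₂ le_rfl hj₂L).symm)
    · rw [show j₂ = ω.2.arcs.length - 1 by omega, hsOutL]; exact Or.inl rfl
  have hqY : (ω.2.fc j₂).2 = Y := (hrun₂ j₂ le_rfl hj₂L).trans hLY
  have hPq := hiso j₂ (by omega) hqY (YBWalk.arcKind_ne_straight_of_S_WE hSN₂ hq_out)
  -- ★ p: the other end of the run through `r`, west of `r`
  obtain ⟨p, hPp, hpY, hpx⟩ : ∃ p : Face, (p ∈ facesL ω.2.mids ∧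
      (kindsL ω.2.mids p = [.corner] ∨ kindsL ω.2.mids p = [.coCorner])) ∧ p.2 = Y ∧ p.1 < r.1 := by
    by_cases hW1 : ω.2.sOut ω.2.firstHitG = .W
    · -- the run STARTS at `r` heading west; its end is an exit turn west of `r`
      obtain ⟨j₁, hFj₁, hj₁, hrun₁, hstop₁, hdir₁⟩ := ω.2.exists_run_end hF
      have hdirW : (∀ k, ω.2.firstHitG ≤ k → k < j₁ → ω.2.sOut k = .W) ∧
          (ω.2.fc j₁).1 + (j₁ - ω.2.firstHitG : ℕ) = (ω.2.fc ω.2.firstHitG).1 := by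
        rcases hdir₁ with hW | ⟨hall, -⟩
        · exact hW
        · rcases Nat.lt_or_ge ω.2.firstHitG j₁ with hlt | hge
          · have := (hall _ le_rfl hlt).symm.trans hW1; exact absurd this (by decide)
          · refine ⟨fun k h1 h2 => by omega, ?_⟩
            rw [show j₁ = ω.2.firstHitG by omega]; simp
      obtain ⟨hallW, hx₁⟩ := hdirW
      rw [hfcF] at hx₁
      rcases hstop₁ with hend | ⟨hj₁1, -, hSN₁⟩
      · -- the run would reach the last arc, which lies EAST of `r`
        exfalso
        rw [show j₁ = ω.2.arcs.length - 1 by omega, hfcL] at hx₁; simp only at hx₁; omega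
      · have hj₁F : ω.2.firstHitG < j₁ := by
          rcases Nat.lt_or_ge ω.2.firstHitG j₁ with hlt | hge
          · exact hlt
          · exfalso
            rw [show j₁ = ω.2.firstHitG by omega, hW1] at hSN₁
            rcases hSN₁ with e | e <;> exact absurd e (by decide)
        have hin₁ : ω.2.sIn j₁ = .E := by
          have := hallW (j₁ - 1) (by omega) (by omega)
          obtain ⟨-, hin⟩ := ω.2.fc_succ_eq_of_sOut_W (i := j₁ - 1) (by omega) this
          rwa [show j₁ - 1 + 1 = j₁ by omega] at hin
        have hj₁Y : (ω.2.fc j₁).2 = Y := (hrun₁ j₁ hFj₁ le_rfl).trans hrFY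
        refine ⟨ω.2.fc j₁, hiso j₁ hj₁ hj₁Y ?_, hj₁Y, by omega⟩
        rw [hin₁]; exact YBWalk.arcKind_ne_straight_of_WE_S (Or.inr rfl) hSN₁
    · -- otherwise the arc ENTERS `r` through `W` (a turn avoiding `E` uses `W`): the run ENDS at `r`, coming from the west
      have hW0 : ω.2.sIn ω.2.firstHitG = .W := by
        have hs0E : ω.2.sIn ω.2.firstHitG ≠ .E := fun e => hs0 (e.trans hzE.symm)
        have hs1E : ω.2.sOut ω.2.firstHitG ≠ .E := fun e => hs1 (e.trans hzE.symm)
        revert hNS hs0E hs1E h10 hW1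
        cases ω.2.sIn ω.2.firstHitG <;> cases ω.2.sOut ω.2.firstHitG <;> decide
      have hF1 : 1 ≤ ω.2.firstHitG := by
        by_contra hlt
        have e0 : ω.2.fc 0 = r := by rw [show 0 = ω.2.firstHitG by omega]; exact hfcF
        exact h0Y (by rw [e0]; exact hrY)
      obtain ⟨j₀, -, hj₀F, hrun₀, hprev₀, hSN₀, hdir₀⟩ := ω.2.exists_run_start hF (by rw [hrFY]; exact h0Y)
      have hpredY : (ω.2.fc (ω.2.firstHitG - 1)).2 = (ω.2.fc ω.2.firstHitG).2 :=
        ω.2.fc_pred_row_of_sIn_WE hF hF1 (Or.inl hW0)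
      have hj₀lt : j₀ < ω.2.firstHitG := by
        rcases Nat.lt_or_ge j₀ ω.2.firstHitG with hlt | hge
        · exact hlt
        · exfalso; rw [show j₀ = ω.2.firstHitG by omega] at hprev₀; exact hprev₀ hpredY
      have hx₀ : (ω.2.fc ω.2.firstHitG).1 = (ω.2.fc j₀).1 + (ω.2.firstHitG - j₀ : ℕ) := by
        rcases hdir₀ with ⟨hall, -⟩ | ⟨-, hx⟩
        · exfalso
          have := hall (ω.2.firstHitG - 1) (by omega) (by omega)
          obtain ⟨-, hin⟩ := ω.2.fc_succ_eq_of_sOut_W (i := ω.2.firstHitG - 1) (by omega) this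
          rw [show ω.2.firstHitG - 1 + 1 = ω.2.firstHitG by omega, hW0] at hin
          exact absurd hin (by decide)
        · exact hx
      rw [hfcF] at hx₀
      have hj₀Y : (ω.2.fc j₀).2 = Y := (hrun₀ j₀ le_rfl hj₀F).trans hrFY
      have hout₀ : ω.2.sOut j₀ = .W ∨ ω.2.sOut j₀ = .E :=
        ω.2.sOut_WE_of_row_eq (by omega)
          ((hrun₀ (j₀ + 1) (by omega) (by omega)).trans (hrun₀ j₀ le_rfl hj₀F).symm)
      exact ⟨ω.2.fc j₀, hiso j₀ (by omega) hj₀Y (YBWalk.arcKind_ne_straight_of_S_WE hSN₀ hout₀), hj₀Y, by omega⟩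
  -- the three plaquettes are distinct: columns `p.1 < r.1 < q.1`
  refine ⟨{p, r, ω.2.fc j₂}, ?_, ?_⟩
  · intro f hf
    simp only [Finset.mem_insert, Finset.mem_singleton] at hf
    rcases hf with hf | hf | hf <;> rw [hf]
    · exact ⟨hPp, hpY⟩
    · exact ⟨hPr, hrY⟩
    · exact ⟨hPq, hqY⟩
  · rw [Finset.card_insert_of_notMem, Finset.card_insert_of_notMem, Finset.card_singleton]
    · intro hm
      rw [Finset.mem_singleton] at hm
      have := congrArg Prod.fst hm; omega
    · intro hm
      simp only [Finset.mem_insert, Finset.mem_singleton] at hm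
      rcases hm with hm | hm
      · have := congrArg Prod.fst hm; omega
      · have := congrArg Prod.fst hm; omega

/-- ★★ **THREE ISOLATED TURNS IN THE ROW OF `r`, END SIDE `W`** (the mirror statement). Let `ω` be a class-`B2a` walk from a hole root whose row-`Y`
plaquettes are singly visited, with `r` in row `Y ≠ w.2`, whose first arc in `r` is a TURN and whose end is the `W` side of `r`. Then
row `Y` contains three different `[corner]`/`[coCorner]` plaquettes: `r`, the far end of the run through `r` (east of `r`) and the
first plaquette of the final run, which reaches the `W` side of `r` from the west. [cite: GlazmanManolescu2019, §1, Fig. 1; Lemma 2.1 (the classes of walks at a rhombus)]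
[cite: Glazman2015WeightedSAW, Lemma 3.1 (proof, pp. 6–7)] -/
theorem three_turns_in_row_W (hh : holeFaceW w ∉ D) (hr : RootedFace D (w.side .W) r) (h : ω.IsB2a) {Y : ℤ}
    (hsv : ∀ i j, i < ω.2.arcs.length → j < ω.2.arcs.length → (ω.2.fc i).2 = Y → ω.2.fc i = ω.2.fc j → i = j)
    (hrY : r.2 = Y) (hwY : w.2 ≠ Y) (hNS : arcKind (ω.2.sIn ω.2.firstHitG) (ω.2.sOut ω.2.firstHitG) ≠ .straight)
    (hzW : ω.1 = .W) :
    ∃ T : Finset Face,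
      (∀ f ∈ T, (f ∈ facesL ω.2.mids ∧ (kindsL ω.2.mids f = [.corner] ∨ kindsL ω.2.mids f = [.coCorner])) ∧ f.2 = Y) ∧
        3 ≤ T.card := by
  classical
  have hF := ω.fh_lt h
  obtain ⟨hfcF, hsInF, hsOutF⟩ := fc_fh ω hr h
  have hlen3 : ω.2.firstHitG + 3 ≤ ω.2.arcs.length := by
    have := three_le_Mv hr h; have := fh_add_Mv h; unfold ΩG.Mv at *; omega
  have hlen : 0 < ω.2.arcs.length := by omega
  have hL : ω.2.arcs.length - 1 < ω.2.arcs.length := by omega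
  have hFL : ω.2.firstHitG < ω.2.arcs.length - 1 := by omega
  have h0 : ω.2.fc 0 = w := fc_zero_eq_root w hh ω.2 hlen
  have h0Y : (ω.2.fc 0).2 ≠ Y := by rw [h0]; exact hwY
  have hrFY : (ω.2.fc ω.2.firstHitG).2 = Y := by rw [hfcF]; exact hrY
  -- the last arc ends on `r.side W` and does not lie in `r`: it lies in the west neighbour and leaves through `E`
  obtain ⟨-, hout⟩ := ω.2.side_sIn_eq_nth hL
  rw [show ω.2.arcs.length - 1 + 1 = ω.2.arcs.length by omega, ω.2.nth_length] at hout
  have hlastne : ω.2.fc (ω.2.arcs.length - 1) ≠ r := fc_ne ω hr h hFL hL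
  have e := hout.trans (show r.side ω.1 = .vert r.1 r.2 by rw [hzW]; rfl)
  obtain ⟨hfcL, hsOutL⟩ : ω.2.fc (ω.2.arcs.length - 1) = (r.1 - 1, r.2) ∧ ω.2.sOut (ω.2.arcs.length - 1) = .E := by
    rcases eq_of_side_eq_vert e with ⟨h2, -⟩ | ⟨h2, hs⟩
    · have e2 : ω.2.fc (ω.2.arcs.length - 1) = r := h2.trans (Prod.ext rfl rfl)
      exact absurd e2 hlastne
    · exact ⟨h2, hs⟩
  have hLY : (ω.2.fc (ω.2.arcs.length - 1)).2 = Y := by rw [hfcL]; exact hrY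
  -- the three sides at `r` are pairwise distinct
  have hd := ω.2.sides_distinctG hr h.1
  rw [ω.returnSide_of_isB2a h] at hd
  have hs0 : ω.2.sIn ω.2.firstHitG ≠ ω.1 := by rw [hsInF]; exact fun e => hd.2.1 e.symm
  have hs1 : ω.2.sOut ω.2.firstHitG ≠ ω.1 := by rw [hsOutF]; exact fun e => hd.2.2 e.symm
  have h10 : ω.2.sIn ω.2.firstHitG ≠ ω.2.sOut ω.2.firstHitG := ω.2.sIn_ne_sOut hF
  -- isolated turns in row `Y`
  have hiso : ∀ i, i < ω.2.arcs.length → (ω.2.fc i).2 = Y → arcKind (ω.2.sIn i) (ω.2.sOut i) ≠ .straight →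
      ω.2.fc i ∈ facesL ω.2.mids ∧ (kindsL ω.2.mids (ω.2.fc i) = [.corner] ∨ kindsL ω.2.mids (ω.2.fc i) = [.coCorner]) :=
    fun i hi hrow hk => isolated_turn hi (fun j hj he => (hsv i j hi hj hrow he.symm).symm) hk
  have hPr := hiso _ hF hrFY hNS
  rw [hfcF] at hPr
  -- ★ q: the final run starts with an entry turn, west of `r`
  obtain ⟨j₂, hj₂1, hj₂L, hrun₂, -, hSN₂, hdir₂⟩ := ω.2.exists_run_start hL (by rw [hLY]; exact h0Y)
  have hqx : (ω.2.fc j₂).1 ≤ r.1 - 1 := by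
    rcases hdir₂ with ⟨hall, hx⟩ | ⟨-, hx⟩
    · rcases Nat.lt_or_ge j₂ (ω.2.arcs.length - 1) with hlt | hge
      · -- heading west, the last arc would enter AND leave through `E`
        have hW' := hall (ω.2.arcs.length - 1 - 1) (by omega) (by omega)
        obtain ⟨-, hin⟩ := ω.2.fc_succ_eq_of_sOut_W (i := ω.2.arcs.length - 1 - 1) (by omega) hW'
        rw [show ω.2.arcs.length - 1 - 1 + 1 = ω.2.arcs.length - 1 by omega] at hin
        exact absurd (hin.trans hsOutL.symm) (ω.2.sIn_ne_sOut hL)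
      · rw [show j₂ = ω.2.arcs.length - 1 by omega, hfcL]
    · rw [hfcL] at hx; simp only at hx; omega
  have hq_out : ω.2.sOut j₂ = .W ∨ ω.2.sOut j₂ = .E := by
    rcases Nat.lt_or_ge j₂ (ω.2.arcs.length - 1) with hlt | hge
    · exact ω.2.sOut_WE_of_row_eq (by omega)
        ((hrun₂ (j₂ + 1) (by omega) (by omega)).trans (hrun₂ j₂ le_rfl hj₂L).symm)
    · rw [show j₂ = ω.2.arcs.length - 1 by omega, hsOutL]; exact Or.inr rfl
  have hqY : (ω.2.fc j₂).2 = Y := (hrun₂ j₂ le_rfl hj₂L).trans hLY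
  have hPq := hiso j₂ (by omega) hqY (YBWalk.arcKind_ne_straight_of_S_WE hSN₂ hq_out)
  -- ★ p: the other end of the run through `r`, east of `r`
  obtain ⟨p, hPp, hpY, hpx⟩ : ∃ p : Face, (p ∈ facesL ω.2.mids ∧
      (kindsL ω.2.mids p = [.corner] ∨ kindsL ω.2.mids p = [.coCorner])) ∧ p.2 = Y ∧ r.1 < p.1 := by
    by_cases hE1 : ω.2.sOut ω.2.firstHitG = .E
    · -- the run STARTS at `r` heading east; its end is an exit turn east of `r`
      obtain ⟨j₁, hFj₁, hj₁, hrun₁, hstop₁, hdir₁⟩ := ω.2.exists_run_end hF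
      have hdirE : (∀ k, ω.2.firstHitG ≤ k → k < j₁ → ω.2.sOut k = .E) ∧
          (ω.2.fc j₁).1 = (ω.2.fc ω.2.firstHitG).1 + (j₁ - ω.2.firstHitG : ℕ) := by
        rcases hdir₁ with ⟨hall, -⟩ | hE
        · rcases Nat.lt_or_ge ω.2.firstHitG j₁ with hlt | hge
          · have := (hall _ le_rfl hlt).symm.trans hE1; exact absurd this (by decide)
          · refine ⟨fun k h1 h2 => by omega, ?_⟩
            rw [show j₁ = ω.2.firstHitG by omega]; simp
        · exact hE
      obtain ⟨hallE, hx₁⟩ := hdirE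
      rw [hfcF] at hx₁
      rcases hstop₁ with hend | ⟨hj₁1, -, hSN₁⟩
      · -- the run would reach the last arc, which lies WEST of `r`
        exfalso
        rw [show j₁ = ω.2.arcs.length - 1 by omega, hfcL] at hx₁; simp only at hx₁; omega
      · have hj₁F : ω.2.firstHitG < j₁ := by
          rcases Nat.lt_or_ge ω.2.firstHitG j₁ with hlt | hge
          · exact hlt
          · exfalso
            rw [show j₁ = ω.2.firstHitG by omega, hE1] at hSN₁
            rcases hSN₁ with e | e <;> exact absurd e (by decide)
        have hin₁ : ω.2.sIn j₁ = .W := by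
          have := hallE (j₁ - 1) (by omega) (by omega)
          obtain ⟨-, hin⟩ := ω.2.fc_succ_eq_of_sOut_E (i := j₁ - 1) (by omega) this
          rwa [show j₁ - 1 + 1 = j₁ by omega] at hin
        have hj₁Y : (ω.2.fc j₁).2 = Y := (hrun₁ j₁ hFj₁ le_rfl).trans hrFY
        refine ⟨ω.2.fc j₁, hiso j₁ hj₁ hj₁Y ?_, hj₁Y, by omega⟩
        rw [hin₁]; exact YBWalk.arcKind_ne_straight_of_WE_S (Or.inl rfl) hSN₁
    · -- otherwise the arc ENTERS `r` through `E` (a turn avoiding `W` uses `E`): the run ENDS at `r`, coming from the east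
      have hE0 : ω.2.sIn ω.2.firstHitG = .E := by
        have hs0W : ω.2.sIn ω.2.firstHitG ≠ .W := fun e => hs0 (e.trans hzW.symm)
        have hs1W : ω.2.sOut ω.2.firstHitG ≠ .W := fun e => hs1 (e.trans hzW.symm)
        revert hNS hs0W hs1W h10 hE1
        cases ω.2.sIn ω.2.firstHitG <;> cases ω.2.sOut ω.2.firstHitG <;> decide
      have hF1 : 1 ≤ ω.2.firstHitG := by
        by_contra hlt
        have e0 : ω.2.fc 0 = r := by rw [show 0 = ω.2.firstHitG by omega]; exact hfcF
        exact h0Y (by rw [e0]; exact hrY)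
      obtain ⟨j₀, -, hj₀F, hrun₀, hprev₀, hSN₀, hdir₀⟩ := ω.2.exists_run_start hF (by rw [hrFY]; exact h0Y)
      have hpredY : (ω.2.fc (ω.2.firstHitG - 1)).2 = (ω.2.fc ω.2.firstHitG).2 :=
        ω.2.fc_pred_row_of_sIn_WE hF hF1 (Or.inr hE0)
      have hj₀lt : j₀ < ω.2.firstHitG := by
        rcases Nat.lt_or_ge j₀ ω.2.firstHitG with hlt | hge
        · exact hlt
        · exfalso; rw [show j₀ = ω.2.firstHitG by omega] at hprev₀; exact hprev₀ hpredY
      have hx₀ : (ω.2.fc ω.2.firstHitG).1 + (ω.2.firstHitG - j₀ : ℕ) = (ω.2.fc j₀).1 := by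
        rcases hdir₀ with ⟨-, hx⟩ | ⟨hall, -⟩
        · exact hx
        · exfalso
          have := hall (ω.2.firstHitG - 1) (by omega) (by omega)
          obtain ⟨-, hin⟩ := ω.2.fc_succ_eq_of_sOut_E (i := ω.2.firstHitG - 1) (by omega) this
          rw [show ω.2.firstHitG - 1 + 1 = ω.2.firstHitG by omega, hE0] at hin
          exact absurd hin (by decide)
      rw [hfcF] at hx₀
      have hj₀Y : (ω.2.fc j₀).2 = Y := (hrun₀ j₀ le_rfl hj₀F).trans hrFY
      have hout₀ : ω.2.sOut j₀ = .W ∨ ω.2.sOut j₀ = .E :=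
        ω.2.sOut_WE_of_row_eq (by omega)
          ((hrun₀ (j₀ + 1) (by omega) (by omega)).trans (hrun₀ j₀ le_rfl hj₀F).symm)
      exact ⟨ω.2.fc j₀, hiso j₀ (by omega) hj₀Y (YBWalk.arcKind_ne_straight_of_S_WE hSN₀ hout₀), hj₀Y, by omega⟩
  -- the three plaquettes are distinct: columns `q.1 < r.1 < p.1`
  refine ⟨{p, r, ω.2.fc j₂}, ?_, ?_⟩
  · intro f hf
    simp only [Finset.mem_insert, Finset.mem_singleton] at hf
    rcases hf with hf | hf | hf <;> rw [hf]
    · exact ⟨hPp, hpY⟩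
    · exact ⟨hPr, hrY⟩
    · exact ⟨hPq, hqY⟩
  · rw [Finset.card_insert_of_notMem, Finset.card_insert_of_notMem, Finset.card_singleton]
    · intro hm
      rw [Finset.mem_singleton] at hm
      have := congrArg Prod.fst hm; omega
    · intro hm
      simp only [Finset.mem_insert, Finset.mem_singleton] at hm
      rcases hm with hm | hm
      · have := congrArg Prod.fst hm; omega
      · have := congrArg Prod.fst hm; omega


/-- In class `B2a` the rooted rhombus `r` carries exactly one arc: the first-crossing arc. [cite: GlazmanManolescu2019, Lemma 2.1 (the classes of walks at a rhombus)] [cite: Glazman2015WeightedSAW, Lemma 3.1 (proof, pp. 6–7)] -/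
theorem eq_firstHitG_of_fc_eq (hr : RootedFace D (w.side .W) r) (h : ω.IsB2a) {j : ℕ} (hj : j < ω.2.arcs.length)
    (he : ω.2.fc j = ω.2.fc ω.2.firstHitG) : j = ω.2.firstHitG := by
  by_contra hne
  obtain ⟨hfcF, -, -⟩ := fc_fh ω hr h
  have hface := (YBWalk.arcFace_arcAt hj).1
  rw [YBWalk.arcAt_eq hj, he, hfcF, ← ω.2.nth_eq_getElem, ← ω.2.nth_eq_getElem] at hface
  exact arcFace_ne_of_isB2a ω hr h hj hne hface

/-- ★★★ **WOUND `NS` WALKS WITH A VERTICAL END COST AT LEAST `7`.** Let `ω` be a class-`B2a` walk from the hole root `a = w.side W`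
(hole `(w.1 − 1, w.2)` absent) whose excursion polygon winds around the midpoint of `a`, whose first arc in `r` is a TURN (an `NS`
group in Glazman–Manolescu's grouping) and whose end `z` is a VERTICAL side of `r`. Then `n_{u₁} + n_{u₂} ≥ 6`, so `cost ≥ 7`: besides
the two-plus-two isolated turns of the extreme rows (`PlaquetteWalkHoleRootWoundCost`), `r` itself is an isolated turn off the extreme
rows, or — when `r` lies in an extreme row, where the count may drop to one — that row carries three isolated turns
(`three_turns_in_row_E/W`); COST PARITY then lifts `5` to `6`. Consequently the class-`B2b` extension of the group (one more arc inside
`r`, ending on the slanted fourth side: cost `= cost ω − 2`) still costs `≥ 5`. [cite: GlazmanManolescu2019, Lemma 2.1 (proof: the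
groups of three walks); §1, Fig. 1; Remark 2.2] [cite: Glazman2015WeightedSAW, Lemma 3.1 (proof, pp. 6–7)]
[cite: CourantRobbins1958, Ch. V Appendix §2 (the even–odd rule)] -/
theorem seven_le_cost_of_wound_NS (hh : holeFaceW w ∉ D) (hr : RootedFace D (w.side .W) r) (h : ω.IsB2a)
    (hA : ω.AJ hr h (toC (midPt (w.side .W))) ≠ 0)
    (hNS : arcKind (ω.2.sIn ω.2.firstHitG) (ω.2.sOut ω.2.firstHitG) ≠ .straight) (hz : ω.1 = .W ∨ ω.1 = .E) :
    7 ≤ cost (slotOfSide ω.1) ω.2.mids := by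
  classical
  have hcost : cost (slotOfSide ω.1) ω.2.mids =
      cfgCount ω.2.mids [.corner] + cfgCount ω.2.mids [.coCorner] + (1 - slotDeg (slotOfSide ω.1)) := rfl
  -- the top row: entry turn and exit turn (or the sideways end)
  obtain ⟨Y, hYw, hY, i₀, i₁, -, hi₀2, hrow₀, hS₀, hWE₀, -, hi₁, hrow₁, -, halt⟩ := top_exit_or_end hh hr h hA
  have hsv : ∀ i, i < ω.2.arcs.length → (ω.2.fc i).2 = Y → ∀ j < ω.2.arcs.length, ω.2.fc j = ω.2.fc i → j = i :=
    fun i hi hrow j hj he => (top_single_visit hh hr h hY (by omega) hi hj hrow he.symm).symm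
  have hi₀ : i₀ < ω.2.arcs.length := by omega
  have hP₀ := isolated_turn hi₀ (hsv i₀ hi₀ hrow₀)
    (by rw [hS₀]; exact YBWalk.arcKind_ne_straight_of_S_WE (Or.inl rfl) hWE₀)
  obtain ⟨T₁, hT₁P, hT₁row, hT₁card⟩ : ∃ T₁ : Finset Face,
      (∀ f ∈ T₁, f ∈ facesL ω.2.mids ∧ (kindsL ω.2.mids f = [.corner] ∨ kindsL ω.2.mids f = [.coCorner])) ∧
      (∀ f ∈ T₁, f.2 = Y) ∧ (2 ≤ T₁.card ∨ (1 ≤ T₁.card ∧ (ω.1 = .W ∨ ω.1 = .E) ∧ r.2 = Y)) := by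
    rcases halt with ⟨hS₁, hWE₁, -, hfne⟩ | ⟨-, hz, hrY⟩
    · have hP₁ := isolated_turn hi₁ (hsv i₁ hi₁ hrow₁)
        (by rw [hS₁]; exact YBWalk.arcKind_ne_straight_of_WE_S hWE₁ (Or.inl rfl))
      refine ⟨{ω.2.fc i₀, ω.2.fc i₁}, ?_, ?_, Or.inl (by rw [Finset.card_pair hfne])⟩
      · intro f hf
        rcases Finset.mem_insert.1 hf with rfl | hf
        · exact hP₀
        · rw [Finset.mem_singleton.1 hf]; exact hP₁
      · intro f hf
        rcases Finset.mem_insert.1 hf with rfl | hf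
        · exact hrow₀
        · rw [Finset.mem_singleton.1 hf]; exact hrow₁
    · exact ⟨{ω.2.fc i₀}, fun f hf => by rw [Finset.mem_singleton.1 hf]; exact hP₀,
        fun f hf => by rw [Finset.mem_singleton.1 hf]; exact hrow₀, Or.inr ⟨by simp, hz, hrY⟩⟩
  -- the bottom row: the twin
  obtain ⟨Y', hYw', hY', j₀, j₁, -, hj₀2, hrow₀', hN₀, hWE₀', -, hj₁, hrow₁', -, halt'⟩ := bottom_exit_or_end hh hr h hA
  have hsv' : ∀ i, i < ω.2.arcs.length → (ω.2.fc i).2 = Y' → ∀ j < ω.2.arcs.length, ω.2.fc j = ω.2.fc i → j = i :=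
    fun i hi hrow j hj he => (bottom_single_visit hh hr h hY' (by omega) hi hj hrow he.symm).symm
  have hj₀ : j₀ < ω.2.arcs.length := by omega
  have hQ₀ := isolated_turn hj₀ (hsv' j₀ hj₀ hrow₀')
    (by rw [hN₀]; exact YBWalk.arcKind_ne_straight_of_S_WE (Or.inr rfl) hWE₀')
  obtain ⟨T₂, hT₂P, hT₂row, hT₂card⟩ : ∃ T₂ : Finset Face,
      (∀ f ∈ T₂, f ∈ facesL ω.2.mids ∧ (kindsL ω.2.mids f = [.corner] ∨ kindsL ω.2.mids f = [.coCorner])) ∧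
      (∀ f ∈ T₂, f.2 = Y') ∧ (2 ≤ T₂.card ∨ (1 ≤ T₂.card ∧ (ω.1 = .W ∨ ω.1 = .E) ∧ r.2 = Y')) := by
    rcases halt' with ⟨hN₁, hWE₁, -, hfne⟩ | ⟨-, hz, hrY⟩
    · have hQ₁ := isolated_turn hj₁ (hsv' j₁ hj₁ hrow₁')
        (by rw [hN₁]; exact YBWalk.arcKind_ne_straight_of_WE_S hWE₁ (Or.inr rfl))
      refine ⟨{ω.2.fc j₀, ω.2.fc j₁}, ?_, ?_, Or.inl (by rw [Finset.card_pair hfne])⟩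
      · intro f hf
        rcases Finset.mem_insert.1 hf with rfl | hf
        · exact hQ₀
        · rw [Finset.mem_singleton.1 hf]; exact hQ₁
      · intro f hf
        rcases Finset.mem_insert.1 hf with rfl | hf
        · exact hrow₀'
        · rw [Finset.mem_singleton.1 hf]; exact hrow₁'
    · exact ⟨{ω.2.fc j₀}, fun f hf => by rw [Finset.mem_singleton.1 hf]; exact hQ₀,
        fun f hf => by rw [Finset.mem_singleton.1 hf]; exact hrow₀', Or.inr ⟨by simp, hz, hrY⟩⟩
  -- `r`: a singly visited plaquette whose arc turns
  have hF := ω.fh_lt h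
  obtain ⟨hfcF, -, -⟩ := fc_fh ω hr h
  have hPr := isolated_turn hF (fun j hj he => eq_firstHitG_of_fc_eq hr h hj he) hNS
  rw [hfcF] at hPr
  -- ★ five isolated turns
  have h5 : 5 ≤ cfgCount ω.2.mids [.corner] + cfgCount ω.2.mids [.coCorner] := by
    by_cases hrT : r.2 = Y
    · -- `r` in the top row: three turns there, two in the bottom row
      have hsvT : ∀ i j, i < ω.2.arcs.length → j < ω.2.arcs.length → (ω.2.fc i).2 = Y → ω.2.fc i = ω.2.fc j → i = j :=
        fun i j hi hj hrow he => top_single_visit hh hr h hY (by omega) hi hj hrow he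
      obtain ⟨T₃, hT₃, hT₃card⟩ : ∃ T : Finset Face, (∀ f ∈ T, (f ∈ facesL ω.2.mids ∧
          (kindsL ω.2.mids f = [.corner] ∨ kindsL ω.2.mids f = [.coCorner])) ∧ f.2 = Y) ∧ 3 ≤ T.card := by
        rcases hz with hzW | hzE
        · exact three_turns_in_row_W hh hr h hsvT hrT (by omega) hNS hzW
        · exact three_turns_in_row_E hh hr h hsvT hrT (by omega) hNS hzE
      have h2 : 2 ≤ T₂.card := by
        rcases hT₂card with h2 | ⟨-, -, hr2⟩
        · exact h2
        · exfalso; omega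
      have hdisj : Disjoint T₃ T₂ := by
        rw [Finset.disjoint_left]
        intro f hf₁ hf₂
        have e1 := (hT₃ f hf₁).2; have e2 := hT₂row f hf₂; omega
      have hcard : T₃.card + T₂.card ≤ cfgCount ω.2.mids [.corner] + cfgCount ω.2.mids [.coCorner] := by
        rw [← Finset.card_union_of_disjoint hdisj]
        exact YBWalk.card_le_cfgCount_add ω.2.mids _ fun f hf => by
          rcases Finset.mem_union.1 hf with hf | hf
          · exact (hT₃ f hf).1
          · exact hT₂P f hf
      omega
    · by_cases hrB : r.2 = Y'
      · -- `r` in the bottom row: three turns there, two in the top row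
        have hsvB : ∀ i j, i < ω.2.arcs.length → j < ω.2.arcs.length → (ω.2.fc i).2 = Y' → ω.2.fc i = ω.2.fc j → i = j :=
          fun i j hi hj hrow he => bottom_single_visit hh hr h hY' (by omega) hi hj hrow he
        obtain ⟨T₃, hT₃, hT₃card⟩ : ∃ T : Finset Face, (∀ f ∈ T, (f ∈ facesL ω.2.mids ∧
            (kindsL ω.2.mids f = [.corner] ∨ kindsL ω.2.mids f = [.coCorner])) ∧ f.2 = Y') ∧ 3 ≤ T.card := by
          rcases hz with hzW | hzE
          · exact three_turns_in_row_W hh hr h hsvB hrB (by omega) hNS hzW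
          · exact three_turns_in_row_E hh hr h hsvB hrB (by omega) hNS hzE
        have h1 : 2 ≤ T₁.card := by
          rcases hT₁card with h1 | ⟨-, -, hr1⟩
          · exact h1
          · exfalso; exact hrT hr1
        have hdisj : Disjoint T₁ T₃ := by
          rw [Finset.disjoint_left]
          intro f hf₁ hf₂
          have e1 := hT₁row f hf₁; have e2 := (hT₃ f hf₂).2; omega
        have hcard : T₁.card + T₃.card ≤ cfgCount ω.2.mids [.corner] + cfgCount ω.2.mids [.coCorner] := by
          rw [← Finset.card_union_of_disjoint hdisj]
          exact YBWalk.card_le_cfgCount_add ω.2.mids _ fun f hf => by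
            rcases Finset.mem_union.1 hf with hf | hf
            · exact hT₁P f hf
            · exact (hT₃ f hf).1
        omega
      · -- `r` off both extreme rows: 2 + 2 + 1
        have h1 : 2 ≤ T₁.card := by
          rcases hT₁card with h1 | ⟨-, -, hr1⟩
          · exact h1
          · exfalso; exact hrT hr1
        have h2 : 2 ≤ T₂.card := by
          rcases hT₂card with h2 | ⟨-, -, hr2⟩
          · exact h2
          · exfalso; exact hrB hr2
        have hdisj : Disjoint T₁ T₂ := by
          rw [Finset.disjoint_left]
          intro f hf₁ hf₂
          have e1 := hT₁row f hf₁; have e2 := hT₂row f hf₂; omega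
        have hr₁ : r ∉ T₁ ∪ T₂ := by
          intro hm
          rcases Finset.mem_union.1 hm with hm | hm
          · exact hrT (hT₁row r hm)
          · exact hrB (hT₂row r hm)
        have hcard : (T₁ ∪ T₂).card + 1 ≤ cfgCount ω.2.mids [.corner] + cfgCount ω.2.mids [.coCorner] := by
          rw [← Finset.card_insert_of_notMem hr₁]
          exact YBWalk.card_le_cfgCount_add ω.2.mids _ fun f hf => by
            rcases Finset.mem_insert.1 hf with hf | hf
            · rw [hf]; exact hPr
            · rcases Finset.mem_union.1 hf with hf | hf
              · exact hT₁P f hf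
              · exact hT₂P f hf
        rw [Finset.card_union_of_disjoint hdisj] at hcard
        omega
  -- ★ COST PARITY: with a vertical root and a vertical end, `n_{u₁} + n_{u₂}` is even, hence `≥ 6`; the vertical end adds `1`
  have hds : ∀ s : Side, (s = .W ∨ s = .E) → slotDeg (slotOfSide s) = 0 ∧ vertB (r.side s) = true := by
    intro s hs
    rcases hs with rfl | rfl
    · exact ⟨by decide, (vertB_side r).1⟩
    · exact ⟨by decide, (vertB_side r).2.1⟩
  obtain ⟨hd, hv⟩ := hds ω.1 hz
  have hpar := cfgCount_corner_add_coCorner_mod_two ω.2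
  rw [(vertB_side w).1] at hpar
  have hp : (cfgCount ω.2.mids [.corner] + cfgCount ω.2.mids [.coCorner]) % 2 = 0 := hpar.trans (by rw [hv]; simp)
  rw [hcost, hd]
  omega

end ΩG

end Literature.Probability.RandomPlanarGeometry.SAW.YangBaxter

namespace Literature.Probability.RandomPlanarGeometry.SAW.YangBaxter

open Real
open Literature.Barriers.CriticalPhenomena.PlaquetteWalk

open private IsNS ext₃_fst ext₃_snd_arcs z₃_spec fc_fh fc_ne fh_add_Mv three_le_Mv sides_distinctG returnSide_of_isB2a from
  Literature.Probability.RandomPlanarGeometry.YangBaxterSAWGeneralDomain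

namespace ΩG

variable {D : Set Face} {w r : Face} {ω : ΩG D (w.side .W) r}

/-! ## The class-`B2b` extension keeps the isolated turns away from `r` -/

/-- **An isolated turn of `ω` in a plaquette other than `r` is an isolated turn of the two-arc extension `ext₃ ω`** (whose arcs are
those of `ω` followed by one more arc inside `r`). [cite: GlazmanManolescu2019, Lemma 2.1 (proof: the groups of three walks); §1, Fig. 1] -/
theorem isolated_turn_ext₃ (hr : RootedFace D (w.side .W) r) (hN : IsNS ω hr) {f : Face} (hf : f ≠ r)
    (hP : f ∈ facesL ω.2.mids ∧ (kindsL ω.2.mids f = [.corner] ∨ kindsL ω.2.mids f = [.coCorner])) :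
    f ∈ facesL (ω.ext₃ hr).2.mids ∧
      (kindsL (ω.ext₃ hr).2.mids f = [.corner] ∨ kindsL (ω.ext₃ hr).2.mids f = [.coCorner]) := by
  have harcs : arcsOf (ω.ext₃ hr).2.mids = arcsOf ω.2.mids ++ [(r.side ω.1, r.side (ω.z₃ hr hN.1))] :=
    ext₃_snd_arcs ω hr hN
  have hface : arcFace (r.side ω.1, r.side (ω.z₃ hr hN.1)) = some r :=
    arcFace_side_side r _ _ (z₃_spec ω hr hN.1).2.2.symm
  have hk : kindsL (ω.ext₃ hr).2.mids f = kindsL ω.2.mids f := by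
    unfold kindsL
    rw [harcs, List.filterMap_append, List.filterMap_cons, List.filterMap_nil, hface,
      if_neg (fun e => hf (Option.some.inj e).symm)]
    simp
  have hm : f ∈ facesL (ω.ext₃ hr).2.mids := by
    have h1 := hP.1
    unfold facesL at h1 ⊢
    rw [List.mem_dedup] at h1 ⊢
    rw [harcs, List.filterMap_append, List.mem_append]
    exact Or.inl h1
  exact ⟨hm, by rw [hk]; exact hP.2⟩

/-- If the rooted rhombus `r` of a class-`B2a` walk from a hole root lies in the TOP row and the first arc in `r` turns, the walk ends on a
VERTICAL side of `r` (a slanted end `S` would make the first arc straight `W–E`, an end `N` would put the last arc above the top row).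
[cite: GlazmanManolescu2019, §1, Fig. 1; Lemma 2.1] -/
theorem end_vertical_of_rooted_top (hh : holeFaceW w ∉ D) (hr : RootedFace D (w.side .W) r) (h : ω.IsB2a) {Y : ℤ}
    (hY : ∀ j < ω.2.arcs.length, (ω.2.fc j).2 ≤ Y) (hYw : w.2 < Y) (hrY : r.2 = Y)
    (hNS : arcKind (ω.2.sIn ω.2.firstHitG) (ω.2.sOut ω.2.firstHitG) ≠ .straight) : ω.1 = .W ∨ ω.1 = .E := by
  have hF := ω.fh_lt h
  obtain ⟨hfcF, hsInF, hsOutF⟩ := fc_fh ω hr h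
  have hlen3 : ω.2.firstHitG + 3 ≤ ω.2.arcs.length := by
    have := three_le_Mv hr h; have := fh_add_Mv h; unfold ΩG.Mv at *; omega
  have hL : ω.2.arcs.length - 1 < ω.2.arcs.length := by omega
  have hrFY : (ω.2.fc ω.2.firstHitG).2 = Y := by rw [hfcF]; exact hrY
  obtain ⟨hs0N, hs1N⟩ := forall_top_ne_N hh hr h hY hYw _ hF hrFY
  have hd := ω.2.sides_distinctG hr h.1
  rw [ω.returnSide_of_isB2a h] at hd
  have hs0 : ω.2.sIn ω.2.firstHitG ≠ ω.1 := by rw [hsInF]; exact fun e => hd.2.1 e.symm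
  have hs1 : ω.2.sOut ω.2.firstHitG ≠ ω.1 := by rw [hsOutF]; exact fun e => hd.2.2 e.symm
  have h10 : ω.2.sIn ω.2.firstHitG ≠ ω.2.sOut ω.2.firstHitG := ω.2.sIn_ne_sOut hF
  -- the last arc
  obtain ⟨-, hout⟩ := ω.2.side_sIn_eq_nth hL
  rw [show ω.2.arcs.length - 1 + 1 = ω.2.arcs.length by omega, ω.2.nth_length] at hout
  have hlastne : ω.2.fc (ω.2.arcs.length - 1) ≠ r := fc_ne ω hr h (by omega) hL
  suffices H : ∀ u, ω.1 = u → u = .W ∨ u = .E from H _ rfl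
  intro u hu
  have hs0u : ω.2.sIn ω.2.firstHitG ≠ u := by rw [← hu]; exact hs0
  have hs1u : ω.2.sOut ω.2.firstHitG ≠ u := by rw [← hu]; exact hs1
  have hlast : u = .N → False := by
    intro huN
    have e := hout.trans (show r.side ω.1 = .slant r.1 (r.2 + 1) by rw [hu, huN]; rfl)
    rcases eq_of_side_eq_slant e with ⟨h2, -⟩ | ⟨h2, -⟩
    · have := hY _ hL; rw [h2] at this; simp only at this; omega
    · exact hlastne (h2.trans (Prod.ext rfl (by simp)))
  revert hNS h10 hs0u hs1u hs0N hs1N hlast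
  cases ω.2.sIn ω.2.firstHitG <;> cases ω.2.sOut ω.2.firstHitG <;> cases u <;> decide

/-- The bottom-row twin: `r` in the BOTTOM row and a turning first arc force a vertical end. [cite: GlazmanManolescu2019, §1, Fig. 1; Lemma 2.1] -/
theorem end_vertical_of_rooted_bottom (hh : holeFaceW w ∉ D) (hr : RootedFace D (w.side .W) r) (h : ω.IsB2a) {Y : ℤ}
    (hY : ∀ j < ω.2.arcs.length, Y ≤ (ω.2.fc j).2) (hYw : Y < w.2) (hrY : r.2 = Y)
    (hNS : arcKind (ω.2.sIn ω.2.firstHitG) (ω.2.sOut ω.2.firstHitG) ≠ .straight) : ω.1 = .W ∨ ω.1 = .E := by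
  have hF := ω.fh_lt h
  obtain ⟨hfcF, hsInF, hsOutF⟩ := fc_fh ω hr h
  have hlen3 : ω.2.firstHitG + 3 ≤ ω.2.arcs.length := by
    have := three_le_Mv hr h; have := fh_add_Mv h; unfold ΩG.Mv at *; omega
  have hL : ω.2.arcs.length - 1 < ω.2.arcs.length := by omega
  have hrFY : (ω.2.fc ω.2.firstHitG).2 = Y := by rw [hfcF]; exact hrY
  obtain ⟨hs0S, hs1S⟩ := forall_bottom_ne_S hh hr h hY hYw _ hF hrFY
  have hd := ω.2.sides_distinctG hr h.1
  rw [ω.returnSide_of_isB2a h] at hd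
  have hs0 : ω.2.sIn ω.2.firstHitG ≠ ω.1 := by rw [hsInF]; exact fun e => hd.2.1 e.symm
  have hs1 : ω.2.sOut ω.2.firstHitG ≠ ω.1 := by rw [hsOutF]; exact fun e => hd.2.2 e.symm
  have h10 : ω.2.sIn ω.2.firstHitG ≠ ω.2.sOut ω.2.firstHitG := ω.2.sIn_ne_sOut hF
  obtain ⟨-, hout⟩ := ω.2.side_sIn_eq_nth hL
  rw [show ω.2.arcs.length - 1 + 1 = ω.2.arcs.length by omega, ω.2.nth_length] at hout
  have hlastne : ω.2.fc (ω.2.arcs.length - 1) ≠ r := fc_ne ω hr h (by omega) hL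
  suffices H : ∀ u, ω.1 = u → u = .W ∨ u = .E from H _ rfl
  intro u hu
  have hs0u : ω.2.sIn ω.2.firstHitG ≠ u := by rw [← hu]; exact hs0
  have hs1u : ω.2.sOut ω.2.firstHitG ≠ u := by rw [← hu]; exact hs1
  have hlast : u = .S → False := by
    intro huS
    have e := hout.trans (show r.side ω.1 = .slant r.1 r.2 by rw [hu, huS]; rfl)
    rcases eq_of_side_eq_slant e with ⟨h2, -⟩ | ⟨h2, -⟩
    · exact hlastne (h2.trans (Prod.ext rfl rfl))
    · have := hY _ hL; rw [h2] at this; simp only at this; omega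
  revert hNS h10 hs0u hs1u hs0S hs1S hlast
  cases ω.2.sIn ω.2.firstHitG <;> cases ω.2.sOut ω.2.firstHitG <;> cases u <;> decide


/-- ★★ **FOUR ISOLATED TURNS AWAY FROM `r`**: a wound class-`B2a` walk from a hole root whose first arc in `r` turns has four different
`[corner]`/`[coCorner]` plaquettes other than `r` (two per extreme row when `r` is off the extreme rows; when `r` lies in an extreme row,
the end is vertical (`end_vertical_of_rooted_top/bottom`) and that row carries three isolated turns, two of them not `r`).
[cite: GlazmanManolescu2019, §1, Fig. 1; Lemma 2.1 (proof: the groups)] [cite: CourantRobbins1958, Ch. V Appendix §2 (the even–odd rule)] -/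
theorem four_turns_off_r (hh : holeFaceW w ∉ D) (hr : RootedFace D (w.side .W) r) (h : ω.IsB2a)
    (hA : ω.AJ hr h (toC (midPt (w.side .W))) ≠ 0)
    (hNS : arcKind (ω.2.sIn ω.2.firstHitG) (ω.2.sOut ω.2.firstHitG) ≠ .straight) :
    ∃ T : Finset Face, (∀ f ∈ T, f ∈ facesL ω.2.mids ∧ (kindsL ω.2.mids f = [.corner] ∨ kindsL ω.2.mids f = [.coCorner])) ∧
      r ∉ T ∧ 4 ≤ T.card := by
  classical
  -- the top row: entry turn and exit turn (or the sideways end)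
  obtain ⟨Y, hYw, hY, i₀, i₁, -, hi₀2, hrow₀, hS₀, hWE₀, -, hi₁, hrow₁, -, halt⟩ := top_exit_or_end hh hr h hA
  have hsv : ∀ i, i < ω.2.arcs.length → (ω.2.fc i).2 = Y → ∀ j < ω.2.arcs.length, ω.2.fc j = ω.2.fc i → j = i :=
    fun i hi hrow j hj he => (top_single_visit hh hr h hY (by omega) hi hj hrow he.symm).symm
  have hi₀ : i₀ < ω.2.arcs.length := by omega
  have hP₀ := isolated_turn hi₀ (hsv i₀ hi₀ hrow₀)
    (by rw [hS₀]; exact YBWalk.arcKind_ne_straight_of_S_WE (Or.inl rfl) hWE₀)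
  obtain ⟨T₁, hT₁P, hT₁row, hT₁card⟩ : ∃ T₁ : Finset Face,
      (∀ f ∈ T₁, f ∈ facesL ω.2.mids ∧ (kindsL ω.2.mids f = [.corner] ∨ kindsL ω.2.mids f = [.coCorner])) ∧
      (∀ f ∈ T₁, f.2 = Y) ∧ (2 ≤ T₁.card ∨ (1 ≤ T₁.card ∧ (ω.1 = .W ∨ ω.1 = .E) ∧ r.2 = Y)) := by
    rcases halt with ⟨hS₁, hWE₁, -, hfne⟩ | ⟨-, hz, hrY⟩
    · have hP₁ := isolated_turn hi₁ (hsv i₁ hi₁ hrow₁)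
        (by rw [hS₁]; exact YBWalk.arcKind_ne_straight_of_WE_S hWE₁ (Or.inl rfl))
      refine ⟨{ω.2.fc i₀, ω.2.fc i₁}, ?_, ?_, Or.inl (by rw [Finset.card_pair hfne])⟩
      · intro f hf
        rcases Finset.mem_insert.1 hf with rfl | hf
        · exact hP₀
        · rw [Finset.mem_singleton.1 hf]; exact hP₁
      · intro f hf
        rcases Finset.mem_insert.1 hf with rfl | hf
        · exact hrow₀
        · rw [Finset.mem_singleton.1 hf]; exact hrow₁
    · exact ⟨{ω.2.fc i₀}, fun f hf => by rw [Finset.mem_singleton.1 hf]; exact hP₀,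
        fun f hf => by rw [Finset.mem_singleton.1 hf]; exact hrow₀, Or.inr ⟨by simp, hz, hrY⟩⟩
  -- the bottom row: the twin
  obtain ⟨Y', hYw', hY', j₀, j₁, -, hj₀2, hrow₀', hN₀, hWE₀', -, hj₁, hrow₁', -, halt'⟩ := bottom_exit_or_end hh hr h hA
  have hsv' : ∀ i, i < ω.2.arcs.length → (ω.2.fc i).2 = Y' → ∀ j < ω.2.arcs.length, ω.2.fc j = ω.2.fc i → j = i :=
    fun i hi hrow j hj he => (bottom_single_visit hh hr h hY' (by omega) hi hj hrow he.symm).symm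
  have hj₀ : j₀ < ω.2.arcs.length := by omega
  have hQ₀ := isolated_turn hj₀ (hsv' j₀ hj₀ hrow₀')
    (by rw [hN₀]; exact YBWalk.arcKind_ne_straight_of_S_WE (Or.inr rfl) hWE₀')
  obtain ⟨T₂, hT₂P, hT₂row, hT₂card⟩ : ∃ T₂ : Finset Face,
      (∀ f ∈ T₂, f ∈ facesL ω.2.mids ∧ (kindsL ω.2.mids f = [.corner] ∨ kindsL ω.2.mids f = [.coCorner])) ∧
      (∀ f ∈ T₂, f.2 = Y') ∧ (2 ≤ T₂.card ∨ (1 ≤ T₂.card ∧ (ω.1 = .W ∨ ω.1 = .E) ∧ r.2 = Y')) := by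
    rcases halt' with ⟨hN₁, hWE₁, -, hfne⟩ | ⟨-, hz, hrY⟩
    · have hQ₁ := isolated_turn hj₁ (hsv' j₁ hj₁ hrow₁')
        (by rw [hN₁]; exact YBWalk.arcKind_ne_straight_of_WE_S hWE₁ (Or.inr rfl))
      refine ⟨{ω.2.fc j₀, ω.2.fc j₁}, ?_, ?_, Or.inl (by rw [Finset.card_pair hfne])⟩
      · intro f hf
        rcases Finset.mem_insert.1 hf with rfl | hf
        · exact hQ₀
        · rw [Finset.mem_singleton.1 hf]; exact hQ₁
      · intro f hf
        rcases Finset.mem_insert.1 hf with rfl | hf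
        · exact hrow₀'
        · rw [Finset.mem_singleton.1 hf]; exact hrow₁'
    · exact ⟨{ω.2.fc j₀}, fun f hf => by rw [Finset.mem_singleton.1 hf]; exact hQ₀,
        fun f hf => by rw [Finset.mem_singleton.1 hf]; exact hrow₀', Or.inr ⟨by simp, hz, hrY⟩⟩
  by_cases hrT : r.2 = Y
  · -- `r` in the top row: the end is vertical, three turns in the top row (two of them not `r`), two in the bottom row
    have hz := end_vertical_of_rooted_top hh hr h hY (by omega) hrT hNS
    have hsvT : ∀ i j, i < ω.2.arcs.length → j < ω.2.arcs.length → (ω.2.fc i).2 = Y → ω.2.fc i = ω.2.fc j → i = j :=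
      fun i j hi hj hrow he => top_single_visit hh hr h hY (by omega) hi hj hrow he
    obtain ⟨T₃, hT₃, hT₃card⟩ : ∃ T : Finset Face, (∀ f ∈ T, (f ∈ facesL ω.2.mids ∧
        (kindsL ω.2.mids f = [.corner] ∨ kindsL ω.2.mids f = [.coCorner])) ∧ f.2 = Y) ∧ 3 ≤ T.card := by
      rcases hz with hzW | hzE
      · exact three_turns_in_row_W hh hr h hsvT hrT (by omega) hNS hzW
      · exact three_turns_in_row_E hh hr h hsvT hrT (by omega) hNS hzE
    have h2 : 2 ≤ T₂.card := by
      rcases hT₂card with h2 | ⟨-, -, hr2⟩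
      · exact h2
      · exfalso; omega
    have hdisj : Disjoint (T₃.erase r) T₂ := by
      rw [Finset.disjoint_left]
      intro f hf₁ hf₂
      have e1 := (hT₃ f (Finset.mem_of_mem_erase hf₁)).2; have e2 := hT₂row f hf₂; omega
    refine ⟨T₃.erase r ∪ T₂, fun f hf => ?_, fun hm => ?_, ?_⟩
    · rcases Finset.mem_union.1 hf with hf | hf
      · exact (hT₃ f (Finset.mem_of_mem_erase hf)).1
      · exact hT₂P f hf
    · rcases Finset.mem_union.1 hm with hm | hm
      · exact (Finset.mem_erase.1 hm).1 rfl
      · have := hT₂row r hm; omega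
    · rw [Finset.card_union_of_disjoint hdisj]
      have := Finset.pred_card_le_card_erase (s := T₃) (a := r)
      omega
  · by_cases hrB : r.2 = Y'
    · -- `r` in the bottom row: the twin
      have hz := end_vertical_of_rooted_bottom hh hr h hY' (by omega) hrB hNS
      have hsvB : ∀ i j, i < ω.2.arcs.length → j < ω.2.arcs.length → (ω.2.fc i).2 = Y' → ω.2.fc i = ω.2.fc j → i = j :=
        fun i j hi hj hrow he => bottom_single_visit hh hr h hY' (by omega) hi hj hrow he
      obtain ⟨T₃, hT₃, hT₃card⟩ : ∃ T : Finset Face, (∀ f ∈ T, (f ∈ facesL ω.2.mids ∧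
          (kindsL ω.2.mids f = [.corner] ∨ kindsL ω.2.mids f = [.coCorner])) ∧ f.2 = Y') ∧ 3 ≤ T.card := by
        rcases hz with hzW | hzE
        · exact three_turns_in_row_W hh hr h hsvB hrB (by omega) hNS hzW
        · exact three_turns_in_row_E hh hr h hsvB hrB (by omega) hNS hzE
      have h1 : 2 ≤ T₁.card := by
        rcases hT₁card with h1 | ⟨-, -, hr1⟩
        · exact h1
        · exact absurd hr1 hrT
      have hdisj : Disjoint T₁ (T₃.erase r) := by
        rw [Finset.disjoint_left]
        intro f hf₁ hf₂
        have e1 := hT₁row f hf₁; have e2 := (hT₃ f (Finset.mem_of_mem_erase hf₂)).2; omega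
      refine ⟨T₁ ∪ T₃.erase r, fun f hf => ?_, fun hm => ?_, ?_⟩
      · rcases Finset.mem_union.1 hf with hf | hf
        · exact hT₁P f hf
        · exact (hT₃ f (Finset.mem_of_mem_erase hf)).1
      · rcases Finset.mem_union.1 hm with hm | hm
        · exact hrT (hT₁row r hm)
        · exact (Finset.mem_erase.1 hm).1 rfl
      · rw [Finset.card_union_of_disjoint hdisj]
        have := Finset.pred_card_le_card_erase (s := T₃) (a := r)
        omega
    · -- `r` off both extreme rows
      have h1 : 2 ≤ T₁.card := by
        rcases hT₁card with h1 | ⟨-, -, hr1⟩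
        · exact h1
        · exact absurd hr1 hrT
      have h2 : 2 ≤ T₂.card := by
        rcases hT₂card with h2 | ⟨-, -, hr2⟩
        · exact h2
        · exact absurd hr2 hrB
      have hdisj : Disjoint T₁ T₂ := by
        rw [Finset.disjoint_left]
        intro f hf₁ hf₂
        have e1 := hT₁row f hf₁; have e2 := hT₂row f hf₂; omega
      refine ⟨T₁ ∪ T₂, fun f hf => ?_, fun hm => ?_, ?_⟩
      · rcases Finset.mem_union.1 hf with hf | hf
        · exact hT₁P f hf
        · exact hT₂P f hf
      · rcases Finset.mem_union.1 hm with hm | hm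
        · exact hrT (hT₁row r hm)
        · exact hrB (hT₂row r hm)
      · rw [Finset.card_union_of_disjoint hdisj]; omega

/-- ★★★ **THE CLASS-`B2b` EXTENSION OF A WOUND `NS` GROUP COSTS AT LEAST `5`.** For a wound class-`B2a` walk `ω` from a hole root whose
first arc in `r` turns, the two-arc extension `ext₃ ω` (Glazman–Manolescu's third group member: one more arc inside `r`, ending on the
fourth side `z₃`) satisfies `5 ≤ cost (slotOfSide z₃) (ext₃ ω).mids`: the four isolated turns of `ω` away from `r` survive the extension
(`isolated_turn_ext₃`), and since the first arc joins a vertical and a slanted side, `z₃` is slanted exactly when the end `ω.1` is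
vertical — then COST PARITY for the extension (root vertical, end slanted: `n_{u₁} + n_{u₂}` odd) lifts `4` to `5`; otherwise `z₃` is
vertical and the end contributes `1`. [cite: GlazmanManolescu2019, Lemma 2.1 (proof: the groups of three walks); §1, Fig. 1; Remark 2.2]
[cite: Glazman2015WeightedSAW, Lemma 3.1 (proof, pp. 6–7)] -/
theorem five_le_cost_ext₃ (hh : holeFaceW w ∉ D) (hr : RootedFace D (w.side .W) r) (h : ω.IsB2a)
    (hA : ω.AJ hr h (toC (midPt (w.side .W))) ≠ 0)
    (hNS : arcKind (ω.2.sIn ω.2.firstHitG) (ω.2.sOut ω.2.firstHitG) ≠ .straight) :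
    5 ≤ cost (slotOfSide (ω.ext₃ hr).1) (ω.ext₃ hr).2.mids := by
  classical
  have hF := ω.fh_lt h
  obtain ⟨hfcF, hsInF, hsOutF⟩ := fc_fh ω hr h
  have hN : IsNS ω hr := ⟨h, by rw [← hsInF, ← hsOutF]; exact hNS⟩
  have hfst : (ω.ext₃ hr).1 = ω.z₃ hr h := ext₃_fst ω hr hN
  have hz3 := z₃_spec ω hr h
  have hd := ω.2.sides_distinctG hr h.1
  rw [ω.returnSide_of_isB2a h] at hd
  have hs0 : ω.2.sIn ω.2.firstHitG ≠ ω.1 := by rw [hsInF]; exact fun e => hd.2.1 e.symm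
  have hs1 : ω.2.sOut ω.2.firstHitG ≠ ω.1 := by rw [hsOutF]; exact fun e => hd.2.2 e.symm
  have h10 : ω.2.sIn ω.2.firstHitG ≠ ω.2.sOut ω.2.firstHitG := ω.2.sIn_ne_sOut hF
  have hz0 : ω.z₃ hr h ≠ ω.2.sIn ω.2.firstHitG := by rw [hsInF]; exact hz3.1
  have hz1 : ω.z₃ hr h ≠ ω.2.sOut ω.2.firstHitG := by rw [hsOutF]; exact hz3.2.1
  have hz2 : ω.z₃ hr h ≠ ω.1 := hz3.2.2
  have hcost : cost (slotOfSide (ω.ext₃ hr).1) (ω.ext₃ hr).2.mids = cfgCount (ω.ext₃ hr).2.mids [.corner] +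
      cfgCount (ω.ext₃ hr).2.mids [.coCorner] + (1 - slotDeg (slotOfSide (ω.ext₃ hr).1)) := rfl
  have hslot : slotDeg (slotOfSide (ω.ext₃ hr).1) = slotDeg (slotOfSide (ω.z₃ hr h)) := by rw [hfst]
  have hvert : vertB (r.side (ω.ext₃ hr).1) = vertB (r.side (ω.z₃ hr h)) := by rw [hfst]
  -- four isolated turns of `ω` away from `r`, transferred to the extension
  obtain ⟨T, hT, hTr, h4⟩ := four_turns_off_r hh hr h hA hNS
  have h4' : 4 ≤ cfgCount (ω.ext₃ hr).2.mids [.corner] + cfgCount (ω.ext₃ hr).2.mids [.coCorner] :=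
    le_trans h4 (YBWalk.card_le_cfgCount_add _ T fun f hf =>
      isolated_turn_ext₃ hr hN (fun e => hTr (by rw [← e]; exact hf)) (hT f hf))
  -- COST PARITY for the extension (a walk from the vertical root to `r.side z₃`)
  have hpar := cfgCount_corner_add_coCorner_mod_two (ω.ext₃ hr).2
  rw [(vertB_side w).1, hvert] at hpar
  -- the fourth side is slanted iff the end is vertical (the first arc joins a vertical and a slanted side)
  have key0 : (slotDeg (slotOfSide (ω.z₃ hr h)) = 1 ∧ (ω.z₃ hr h = .S ∨ ω.z₃ hr h = .N)) ∨
      (slotDeg (slotOfSide (ω.z₃ hr h)) = 0 ∧ (ω.z₃ hr h = .W ∨ ω.z₃ hr h = .E)) := by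
    suffices H : ∀ u, ω.1 = u → (slotDeg (slotOfSide (ω.z₃ hr h)) = 1 ∧ (ω.z₃ hr h = .S ∨ ω.z₃ hr h = .N)) ∨
        (slotDeg (slotOfSide (ω.z₃ hr h)) = 0 ∧ (ω.z₃ hr h = .W ∨ ω.z₃ hr h = .E)) from H _ rfl
    intro u hu
    have hs0u : ω.2.sIn ω.2.firstHitG ≠ u := by rw [← hu]; exact hs0
    have hs1u : ω.2.sOut ω.2.firstHitG ≠ u := by rw [← hu]; exact hs1
    have hz2u : ω.z₃ hr h ≠ u := by rw [← hu]; exact hz2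
    revert hNS h10 hs0u hs1u hz0 hz1 hz2u
    generalize ω.z₃ hr h = t
    cases ω.2.sIn ω.2.firstHitG <;> cases ω.2.sOut ω.2.firstHitG <;> cases u <;> cases t <;> decide
  obtain ⟨hrW, hrE, hrS, hrN⟩ := vertB_side r
  have key : (slotDeg (slotOfSide (ω.z₃ hr h)) = 1 ∧ vertB (r.side (ω.z₃ hr h)) = false) ∨
      (slotDeg (slotOfSide (ω.z₃ hr h)) = 0 ∧ vertB (r.side (ω.z₃ hr h)) = true) := by
    rcases key0 with ⟨hd1, ht | ht⟩ | ⟨hd0, ht | ht⟩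
    · exact Or.inl ⟨hd1, by rw [ht]; exact hrS⟩
    · exact Or.inl ⟨hd1, by rw [ht]; exact hrN⟩
    · exact Or.inr ⟨hd0, by rw [ht]; exact hrW⟩
    · exact Or.inr ⟨hd0, by rw [ht]; exact hrE⟩
  rcases key with ⟨hd1, hvf⟩ | ⟨hd0, hvt⟩
  · have hp : (cfgCount (ω.ext₃ hr).2.mids [.corner] + cfgCount (ω.ext₃ hr).2.mids [.coCorner]) % 2 = 1 :=
      hpar.trans (by rw [hvf]; simp)
    rw [hcost, hslot, hd1]; omega
  · rw [hcost, hslot, hd0]; omega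

end ΩG

end Literature.Probability.RandomPlanarGeometry.SAW.YangBaxter

/-! ## The hypothesis `WoundCostGE 5` of the wound form, discharged for hole roots -/

namespace Literature.Barriers.CriticalPhenomena.PlaquetteWalk

open Literature.Probability.RandomPlanarGeometry.SAW.YangBaxter

open private IsNS fc_fh from Literature.Probability.RandomPlanarGeometry.YangBaxterSAWGeneralDomain

/-- ★★★ **EVERY MEMBER OF A WOUND GROUP AT A HOLE ROOT COSTS AT LEAST `5`**: for the root `a = w.side W` of a finite domain `dom Dl` with
the hole `(w.1 − 1, w.2)` absent and any rooted rhombus `f₀`, `WoundCostGE Dl a f₀ hr 5` — the hypothesis of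
`PlaquetteWalkAngleLimitCoefficientWound.ybVFPoly_coeff_eq_woundLimitCoeff` at level `5`: the class-`B2a` member by
`ΩG.five_le_cost_of_wound` (its own excursion winds, `ΩG.unwound_iff_AJ_root_eq_zero`), the class-`B2b` extension of an `NS` group by
`ΩG.five_le_cost_ext₃`. Hence the coefficient of `Z^{4K−4}` of the cleared vertex functional is the level-`5` wound limit sum, with no
hypothesis. [cite: GlazmanManolescu2019, Lemma 2.1 (proof: the groups) and eq. (1)] [cite: Glazman2015WeightedSAW, Lemma 3.1 (proof)] -/
theorem woundCostGE_five (Dl : List Face) {w f₀ : Face} (hh : holeFaceW w ∉ dom Dl) (hr : RootedFace (dom Dl) (w.side .W) f₀) :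
    WoundCostGE Dl (w.side .W) f₀ hr 5 := by
  classical
  intro ω hω
  rw [Finset.mem_filter] at hω
  obtain ⟨hmem, hU⟩ := hω
  rw [ΩG.unwound_iff_AJ_root_eq_zero] at hU
  push Not at hU
  obtain ⟨h, hA⟩ := hU
  obtain ⟨hfcF, hsInF, hsOutF⟩ := fc_fh ω hr h
  refine ⟨ΩG.five_le_cost_of_wound hh hr h hA, fun hN => ?_⟩
  have hN' : ∃ hB : ω.IsB2a, arcKind ω.2.firstSideG (ω.2.exitSideG hr (ω.fh_lt hB)) ≠ .straight := hN
  obtain ⟨hB, hk⟩ := hN'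
  have hNS : arcKind (ω.2.sIn ω.2.firstHitG) (ω.2.sOut ω.2.firstHitG) ≠ .straight := by
    rw [hsInF, hsOutF]; exact hk
  exact ΩG.five_le_cost_ext₃ hh hr h hA hNS

/-- ★★★ Consequently, unconditionally at a hole root: **the coefficient of `Z^{4K−4}` of the cleared vertex functional is the level-`5`
wound limit sum `Λ₅ = woundLimitCoeff 5`, and `deg P ≤ 4K − 4`.** [cite: GlazmanManolescu2019, Lemma 2.1 (proof: the groups) and eq. (1)] -/
theorem ybVFPoly_coeff_eq_woundLimitCoeff_five (Dl : List Face) {w f₀ : Face} (hh : holeFaceW w ∉ dom Dl)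
    (hr : RootedFace (dom Dl) (w.side .W) f₀) {K : ℕ} (hK : maxExp Dl (w.side .W) f₀ ≤ K) :
    (ybVFPoly Dl (w.side .W) f₀ K).coeff (4 * K + 1 - 5) = woundLimitCoeff Dl (w.side .W) f₀ hr K 5 ∧
      (ybVFPoly Dl (w.side .W) f₀ K).natDegree ≤ 4 * K + 1 - 5 :=
  ⟨ybVFPoly_coeff_eq_woundLimitCoeff Dl (w.side .W) f₀ hr hK (woundCostGE_five Dl hh hr),
    natDegree_ybVFPoly_le_of_woundCostGE Dl (w.side .W) f₀ hr hK (woundCostGE_five Dl hh hr)⟩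

end Literature.Barriers.CriticalPhenomena.PlaquetteWalk
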